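import Summits.BirchSwinnertonDyer.BirchSwinnertonDyer.Theorems.GenusKolyvaginAtTwoTorsionCellSELTwistKernel
import HarnessLib

/-!
# SEL (iso-class Selmer pair law), C1-E: the square-free kernel of a Selmer component of the NEGATIVE twist `E^{(−p₀M)}`

Crux R″ `RankOneTwoTorsionResidualAtTwo` (stmt-27478), LINE 49 «full_vertex», SUPPORT stub SEL
`IsoClassSelmerPairLawAtTwo`, the `C₁ = E₀^{(−p₀M₀)}` half (LEAD memo
`Cruxes/…/Lines/torsion_cell_full_vertex_SEL_C1_road_g36.md`, §5 file C1-E/F).  Setting: `E/ℚ` with rational `2`-torsion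
`a₁, a₂, a₃` (any labelling), `S` a finite set of primes off which the root differences are units, `Q` a finite set of
primes `≡ 3 (mod 4)` disjoint from `S` forming one square class at every `ℓ ∈ S`, a prime `p₀ ≡ 3 (mod 4)` outside
`S ∪ Q`, and the twist `E^{(d)}`, `d = −p₀ · ∏_{q∈Q} q`.

* **`exists_intKernel_of_mem_selmerGroup_negTwist`** — a component `[a]` of a class `c ∈ Sel⁽²⁾(E^{(d)}/ℚ)` is
  `[m · (−p₀)^γ · ∏_{i ∈ m_a} i]` with `m_a = {i ∈ Q : v_i(a) odd}` the `Q`-support, `γ = v_{p₀}(a) mod 2`, and `m ≠ 0`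
  an `S`-supported integer; the residue bit `qr_q(m)` is the same at every `q ∈ Q`; `sgn a = sgn m + γ`; and the residues
  of `a` at a row prime `j ∈ Q` and at `p₀` are
  `qr_j(a) = qr_j(m) + γ·[−p₀/j] + Σ_{i∈Q∖j} (1 + [−i/j])·v_i(a)`, `qr_{p₀}(a) = qr_{p₀}(m) + γ + Σ_{i∈Q} [−p₀/i]·v_i(a)`
  (`[q/p₀] = [−p₀/q]` for primes `≡ 3 (mod 4)`).

The `k`-prime analogue, for the negative twist, of part II (`…SELTwistKernel`) and of
`…D0TripleTwistKernel.exists_intKernel_of_mem_selmerGroup_twist_triple` (`k = 2`).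
Everything is proved; no LINE 49 statement is restated; BSD is not advanced by this file alone.

## References

* [SilvermanAEC2009] J. H. Silverman, *The Arithmetic of Elliptic Curves*, 2nd ed., Prop. X.1.4, Prop. X.4.9.
* [Kane2013SelmerTwists] D. M. Kane, Algebra Number Theory 7 (2013), §2.
* [HeathBrown1994SelmerCongruentII] D. R. Heath-Brown, Invent. Math. 118 (1994), §2.
-/

noncomputable section

open scoped Classical

namespace Summit.BirchSwinnertonDyer.BirchSwinnertonDyer.Theorems.GenusKolyvaginAtTwo.TorsionCellSEL

open WeierstrassCurve WeierstrassCurve.Affine WeierstrassCurve.Affine.Point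
open Literature.NumberTheory.GaloisRepresentations Literature.NumberTheory.EllipticCurves Field
open Literature.NumberTheory.EllipticCurves.TwoDescentLocal
open Literature.NumberTheory.EllipticCurves.KramerTwoDescent
open Summit.BirchSwinnertonDyer.BirchSwinnertonDyer.Theorems.GenusKolyvaginAtTwo.TorsionCellD0
open IsDedekindDomain NumberField Rat.HeightOneSpectrum

/-! ## Bookkeeping -/

section Bookkeeping

/-- An `S`-supported square-free kernel `ε ∏_{ℓ∈T} ℓ` as an integer. [folklore] -/
private theorem kernel_intCast' {T : Finset ℕ} {ε : ℚ} (hε : ε = 1 ∨ ε = -1) :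
    ∃ m : ℤ, (m : ℚ) = ε * ∏ ℓ ∈ T, (ℓ : ℚ) ∧ ∀ q : ℕ, q.Prime → q ∉ T → (∀ ℓ ∈ T, ℓ.Prime) → ¬ (q : ℤ) ∣ m := by
  have hεZ : ∃ e : ℤ, (e : ℚ) = ε ∧ (e = 1 ∨ e = -1) := by
    rcases hε with h1 | h1
    · exact ⟨1, by rw [h1]; norm_num, Or.inl rfl⟩
    · exact ⟨-1, by rw [h1]; norm_num, Or.inr rfl⟩
  obtain ⟨e, he, he1⟩ := hεZ
  refine ⟨e * ∏ ℓ ∈ T, (ℓ : ℤ), by rw [← he]; push_cast; rfl, ?_⟩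
  intro q hq hqT hTp hdvd
  have hqprime : Prime (q : ℤ) := Nat.prime_iff_prime_int.mp hq
  rcases hqprime.dvd_or_dvd hdvd with h1 | h2
  · rcases he1 with rfl | rfl
    · exact hq.one_lt.ne' (by exact_mod_cast Int.eq_one_of_dvd_one (by norm_num) h1)
    · exact hq.one_lt.ne' (by exact_mod_cast Int.eq_one_of_dvd_one (by norm_num) (Int.dvd_neg.mpr h1))
  · obtain ⟨ℓ, hℓT, hℓ⟩ := (Prime.dvd_finsetProd_iff hqprime _).mp h2
    have := (Nat.prime_dvd_prime_iff_eq hq (hTp ℓ hℓT)).mp (by exact_mod_cast hℓ)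
    exact hqT (this ▸ hℓT)

/-- Splitting a product over `T ⊆ S ∪ Q` (`Q` disjoint from `S`) into its `S`-part and its `Q`-part. [folklore] -/
private theorem prod_split' {S Q T : Finset ℕ} (hQS : ∀ q ∈ Q, q ∉ S) (hT : T ⊆ S ∪ Q) {β : Type*} [CommMonoid β]
    (f : ℕ → β) : ∏ ℓ ∈ T, f ℓ = (∏ ℓ ∈ T.filter (· ∈ S), f ℓ) * ∏ ℓ ∈ T.filter (· ∈ Q), f ℓ := by
  rw [← Finset.prod_filter_mul_prod_filter_not T (· ∈ S)]
  congr 1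
  refine Finset.prod_congr ?_ fun _ _ => rfl
  ext ℓ
  simp only [Finset.mem_filter]
  constructor
  · rintro ⟨hℓT, hℓS⟩
    rcases Finset.mem_union.mp (hT hℓT) with h | h
    · exact absurd h hℓS
    · exact ⟨hℓT, h⟩
  · rintro ⟨hℓT, hℓQ⟩
    exact ⟨hℓT, hQS ℓ hℓQ⟩

/-- A bit of `ℤ/2` is `0` or `1`. [folklore] -/
private theorem zmod2_cases' (x : ZMod 2) : x = 0 ∨ x = 1 := by revert x; decide

/-- **`qr_{p}(i) = [−p/i]`** for distinct primes `p ≡ i ≡ 3 (mod 4)` (reciprocity: `[i/p] = 1 + [−i/p] = [−p/i]`).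
[cite: HeathBrown1994SelmerCongruentII, §2] -/
theorem qrBit_natCast_prime_eq_jacobiBit {p i : ℕ} [hp : Fact p.Prime] (hi : i.Prime) (hip : i ≠ p) (hp4 : p % 4 = 3)
    (hi4 : i % 4 = 3) :
    qrBit p (i : ℚ) = (if jacobiSym (-(p : ℤ)) i = -1 then (1 : ZMod 2) else 0) := by
  rw [qrBit_natCast_prime_eq_one_add hp4 hi hip]
  have h := jacobiBit_add_jacobiBit_eq_one hi hp.out hip hi4 hp4
  -- `[−i/p] + [−p/i] = 1`
  have : (if jacobiSym (-(i : ℤ)) p = -1 then (1 : ZMod 2) else 0) =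
      1 + (if jacobiSym (-(p : ℤ)) i = -1 then (1 : ZMod 2) else 0) := by
    linear_combination (norm := ring_nf) h
    rw [show (2 : ZMod 2) = 0 by decide]; ring
  rw [this, ← add_assoc, CharTwo.add_self_eq_zero, zero_add]

end Bookkeeping

/-! ## The kernel of a Selmer component of `E^{(−p₀M)}` -/

section Kernel

variable (E : WeierstrassCurve ℚ) [E.IsElliptic] (S Q : Finset ℕ)

/-- **Square-free kernel of a component of a Selmer class of the negative twist `E^{(d)}`, `d = −p₀ ∏_{q∈Q} q`.**
If `c ∈ Sel⁽²⁾(E^{(d)}/ℚ)` has `h`-component `[a]`, then `[a] = [m · (−p₀)^γ · ∏_{i∈m_a} i]` in `ℚˣ/ℚˣ²`, where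
`m_a = {i ∈ Q : v_i(a) odd}`, `γ = v_{p₀}(a) mod 2`, `m ≠ 0` is an integer all of whose prime factors lie in `S`;
`qr_q(m)` is the same at all `q ∈ Q`; `sgn a = sgn m + γ`; and the residues at a row prime `j ∈ Q` and at `p₀` are
`qr_j(a) = qr_j(m) + γ[−p₀/j] + Σ_{i∈Q∖j} (1 + [−i/j])·v_i(a)` and `qr_{p₀}(a) = qr_{p₀}(m) + γ + Σ_{i∈Q} [−p₀/i]·v_i(a)`.
[cite: SilvermanAEC2009, Prop. X.1.4, Prop. X.4.9] [cite: Kane2013SelmerTwists, §2] -/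
theorem exists_intKernel_of_mem_selmerGroup_negTwist {a₁ a₂ a₃ : ℚ} (h : E.toAffine.SplitTwoTorsion a₁ a₂ a₃)
    (hS : ∀ ℓ ∈ S, ℓ.Prime)
    (hgood : ∀ ℓ : ℕ, (hℓ : ℓ.Prime) → ℓ ∉ S → haveI : Fact ℓ.Prime := ⟨hℓ⟩;
      padicValRat ℓ (a₁ - a₂) = 0 ∧ padicValRat ℓ (a₁ - a₃) = 0)
    (hQ : ∀ q ∈ Q, q.Prime) (hQS : ∀ q ∈ Q, q ∉ S) (hQ4 : ∀ q ∈ Q, q % 4 = 3)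
    (hiso8 : ∀ q ∈ Q, ∀ q' ∈ Q, q % 8 = q' % 8)
    (hisoS : ∀ q ∈ Q, ∀ q' ∈ Q, ∀ ℓ ∈ S, (hℓ : ℓ.Prime) → ℓ ≠ 2 → haveI : Fact ℓ.Prime := ⟨hℓ⟩;
      legendreSym ℓ ((q : ℤ) * q') = 1)
    {p₀ : ℕ} [hp₀ : Fact p₀.Prime] (hp₀S : p₀ ∉ S) (hp₀Q : p₀ ∉ Q) (hp₀4 : p₀ % 4 = 3)
    {d : ℚ} (hd : d = -(p₀ : ℚ) * ∏ q ∈ Q, (q : ℚ)) [(E.quadraticTwist d).IsElliptic]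
    {c : galH1Torsion (E.quadraticTwist d) 2} (hc : c ∈ selmerGroup (E.quadraticTwist d) 2) (a : ℚˣ)
    (ha : kummerEquiv ℚ 2 ((E.quadraticTwist d).twoTorsionCharH1 (h.quadraticTwist d) c) =
      Additive.ofMul (QuotientGroup.mk a)) :
    ∃ (m : ℤ) (γ : ZMod 2), (m : ℚ) ≠ 0 ∧ (∀ ℓ : ℕ, ℓ.Prime → ℓ ∉ S → ¬ (ℓ : ℤ) ∣ m) ∧
      parityBit p₀ (a : ℚ) = γ ∧
      (∃ hg : (m : ℚ) * (if γ = 1 then -(p₀ : ℚ) else 1) * ∏ i ∈ Q.filter (fun i => parityBit i (a : ℚ) = 1), (i : ℚ) ≠ 0,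
        (QuotientGroup.mk a : SqUnits ℚ) = QuotientGroup.mk (Units.mk0 _ hg)) ∧
      (∀ q ∈ Q, ∀ q' ∈ Q, (hq : q.Prime) → (hq' : q'.Prime) →
        haveI : Fact q.Prime := ⟨hq⟩; haveI : Fact q'.Prime := ⟨hq'⟩; qrBit q (m : ℚ) = qrBit q' (m : ℚ)) ∧
      signBit (a : ℚ) = signBit (m : ℚ) + γ ∧
      (∀ j ∈ Q, (hj : j.Prime) → haveI : Fact j.Prime := ⟨hj⟩;
        qrBit j (a : ℚ) = qrBit j (m : ℚ) + γ * (if jacobiSym (-(p₀ : ℤ)) j = -1 then (1 : ZMod 2) else 0) +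
          ∑ i ∈ Q.erase j, (1 + (if jacobiSym (-(i : ℤ)) j = -1 then (1 : ZMod 2) else 0)) * parityBit i (a : ℚ)) ∧
      qrBit p₀ (a : ℚ) = qrBit p₀ (m : ℚ) + γ +
        ∑ i ∈ Q, (if jacobiSym (-(p₀ : ℤ)) i = -1 then (1 : ZMod 2) else 0) * parityBit i (a : ℚ) := by
  subst hd
  set d : ℚ := -(p₀ : ℚ) * ∏ q ∈ Q, (q : ℚ) with hd
  have h' := h.quadraticTwist d
  have hQ0 : ∀ q ∈ Q, (q : ℚ) ≠ 0 := fun q hq => by exact_mod_cast (hQ q hq).ne_zero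
  have hP0 : ∏ q ∈ Q, (q : ℚ) ≠ 0 := Finset.prod_ne_zero_iff.mpr hQ0
  have hPpos : (0 : ℚ) < ∏ q ∈ Q, (q : ℚ) := Finset.prod_pos fun q hq => by exact_mod_cast (hQ q hq).pos
  have hp0 : (p₀ : ℚ) ≠ 0 := by exact_mod_cast hp₀.out.ne_zero
  have hd0 : d ≠ 0 := mul_ne_zero (neg_ne_zero.mpr hp0) hP0
  -- kernel relative to `S' = S ∪ Q ∪ {p₀}`
  set S' : Finset ℕ := insert p₀ (S ∪ Q) with hS'
  have hS'p : ∀ q ∈ S', q.Prime := fun q hq => by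
    rcases Finset.mem_insert.mp hq with rfl | hq
    · exact hp₀.out
    · rcases Finset.mem_union.mp hq with hq | hq
      · exact hS q hq
      · exact hQ q hq
  have hvd : ∀ ℓ : ℕ, (hℓ : ℓ.Prime) → ℓ ∉ S' → haveI : Fact ℓ.Prime := ⟨hℓ⟩; padicValRat ℓ d = 0 := by
    intro ℓ hℓ hℓS'
    haveI : Fact ℓ.Prime := ⟨hℓ⟩
    have hℓp : ℓ ≠ p₀ := fun e => hℓS' (e ▸ Finset.mem_insert_self _ _)
    have hℓQ : ℓ ∉ Q := fun e => hℓS' (Finset.mem_insert_of_mem (Finset.mem_union_right S e))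
    rw [hd, padicValRat.mul (neg_ne_zero.mpr hp0) hP0, padicValRat.neg, padicValRat_prod_primes hQ ℓ, if_neg hℓQ,
      show (p₀ : ℚ) = ((p₀ : ℕ) : ℚ) from rfl, padicValRat.of_nat, padicValNat_primes hℓp]
    rfl
  have hgood' : ∀ ℓ : ℕ, (hℓ : ℓ.Prime) → ℓ ∉ S' → haveI : Fact ℓ.Prime := ⟨hℓ⟩;
      padicValRat ℓ (d * a₁ - d * a₂) = 0 ∧ padicValRat ℓ (d * a₁ - d * a₃) = 0 := by
    intro ℓ hℓ hℓS'
    haveI : Fact ℓ.Prime := ⟨hℓ⟩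
    have hℓS : ℓ ∉ S := fun e => hℓS' (Finset.mem_insert_of_mem (Finset.mem_union_left Q e))
    obtain ⟨g12, g13⟩ := hgood ℓ hℓ hℓS
    have hv := hvd ℓ hℓ hℓS'
    exact ⟨by rw [← mul_sub, padicValRat.mul hd0 (sub_ne_zero.mpr h.ne₁₂), hv, g12, add_zero],
      by rw [← mul_sub, padicValRat.mul hd0 (sub_ne_zero.mpr h.ne₁₃), hv, g13, add_zero]⟩
  obtain ⟨T, hTS', ε, hε, hεpos, hg, hmk, hpar, -⟩ :=
    (E.quadraticTwist d).exists_kernel_of_mem_selmerGroup h' S' hS'p hgood' hc a ha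
  have hTp : ∀ ℓ ∈ T, ℓ.Prime := fun ℓ hℓ => hS'p ℓ (hTS' hℓ)
  have hε0 : ε ≠ 0 := by rcases hε with h1 | h1 <;> rw [h1] <;> norm_num
  -- the `p₀`-parity `γ` and the adjusted sign
  set γ : ZMod 2 := if p₀ ∈ T then 1 else 0 with hγ
  have hγa : parityBit p₀ (a : ℚ) = γ := hpar p₀
  set ε' : ℚ := ε * (if p₀ ∈ T then -1 else 1) with hε'
  have hε'1 : ε' = 1 ∨ ε' = -1 := by
    rcases hε with h1 | h1 <;> by_cases hpT : p₀ ∈ T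
    · right; rw [hε', h1, if_pos hpT]; norm_num
    · left; rw [hε', h1, if_neg hpT]; norm_num
    · left; rw [hε', h1, if_pos hpT]; norm_num
    · right; rw [hε', h1, if_neg hpT]; norm_num
  have hε'0 : ε' ≠ 0 := by rcases hε'1 with h1 | h1 <;> rw [h1] <;> norm_num
  -- the three parts of `T`
  set T₁ : Finset ℕ := T.erase p₀ with hT₁
  have hT₁SQ : T₁ ⊆ S ∪ Q := fun ℓ hℓ => by
    have hℓT : ℓ ∈ T := Finset.mem_of_mem_erase hℓ
    rcases Finset.mem_insert.mp (hTS' hℓT) with e | e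
    · exact absurd e (Finset.ne_of_mem_erase hℓ)
    · exact e
  have hT₀S : T₁.filter (· ∈ S) ⊆ S := fun ℓ hℓ => (Finset.mem_filter.mp hℓ).2
  have hT₀p : ∀ ℓ ∈ T₁.filter (· ∈ S), ℓ.Prime := fun ℓ hℓ => hS ℓ (hT₀S hℓ)
  obtain ⟨m, hm, hmdiv⟩ := kernel_intCast' (T := T₁.filter (· ∈ S)) hε'1
  have hprod0 : (0 : ℚ) < ∏ ℓ ∈ T₁.filter (· ∈ S), (ℓ : ℚ) :=
    Finset.prod_pos fun ℓ hℓ => by exact_mod_cast (hT₀p ℓ hℓ).pos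
  have hm0 : (m : ℚ) ≠ 0 := by rw [hm]; exact mul_ne_zero hε'0 hprod0.ne'
  -- the `Q`-part of the kernel is the `Q`-support of the component
  have hQpart : T₁.filter (· ∈ Q) = Q.filter (fun i => parityBit i (a : ℚ) = 1) := by
    ext i
    simp only [Finset.mem_filter, hT₁, Finset.mem_erase]
    constructor
    · rintro ⟨⟨-, hiT⟩, hiQ⟩
      haveI : Fact i.Prime := ⟨hQ i hiQ⟩
      exact ⟨hiQ, by rw [hpar i, if_pos hiT]⟩
    · rintro ⟨hiQ, hpi⟩
      haveI : Fact i.Prime := ⟨hQ i hiQ⟩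
      have hip : i ≠ p₀ := fun e => hp₀Q (e ▸ hiQ)
      have := hpar i
      rw [hpi] at this
      by_cases hiT : i ∈ T
      · exact ⟨⟨hip, hiT⟩, hiQ⟩
      · rw [if_neg hiT] at this; exact absurd this one_ne_zero
  have hmaQ : Q.filter (fun i => parityBit i (a : ℚ) = 1) ⊆ Q := Finset.filter_subset _ _
  have hprodQ0 : ∏ i ∈ Q.filter (fun i => parityBit i (a : ℚ) = 1), (i : ℚ) ≠ 0 :=
    Finset.prod_ne_zero_iff.mpr fun i hi => hQ0 i (hmaQ hi)
  have hX0 : (if γ = 1 then -(p₀ : ℚ) else 1) ≠ 0 := by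
    split_ifs
    · exact neg_ne_zero.mpr hp0
    · exact one_ne_zero
  -- the kernel identity `ε ∏_T ℓ = m · (−p₀)^γ · ∏_{m_a} i`
  have hker : ε * ∏ ℓ ∈ T, (ℓ : ℚ) =
      (m : ℚ) * (if γ = 1 then -(p₀ : ℚ) else 1) * ∏ i ∈ Q.filter (fun i => parityBit i (a : ℚ) = 1), (i : ℚ) := by
    rw [← hQpart, hm]
    by_cases hpT : p₀ ∈ T
    · have hγ1 : γ = 1 := by rw [hγ, if_pos hpT]
      rw [if_pos hγ1, hε', if_pos hpT, ← Finset.mul_prod_erase T (fun ℓ => (ℓ : ℚ)) hpT, ← hT₁,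
        prod_split' hQS hT₁SQ (fun ℓ => (ℓ : ℚ))]
      ring
    · have hγ0 : γ = 0 := by rw [hγ, if_neg hpT]
      have hT₁T : T₁ = T := Finset.erase_eq_of_notMem hpT
      rw [if_neg (by rw [hγ0]; exact zero_ne_one), hε', if_neg hpT, ← hT₁T, prod_split' hQS hT₁SQ (fun ℓ => (ℓ : ℚ))]
      ring
  have hg' : (m : ℚ) * (if γ = 1 then -(p₀ : ℚ) else 1) * ∏ i ∈ Q.filter (fun i => parityBit i (a : ℚ) = 1), (i : ℚ) ≠ 0 := by
    rw [← hker]; exact hg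
  -- the residue bit of `m` at `q ∈ Q` does not depend on `q`
  have hηconst : ∀ q ∈ Q, ∀ q' ∈ Q, (hq : q.Prime) → (hq' : q'.Prime) →
      haveI : Fact q.Prime := ⟨hq⟩; haveI : Fact q'.Prime := ⟨hq'⟩; qrBit q (m : ℚ) = qrBit q' (m : ℚ) := by
    intro q hq q' hq' hqp hqp'
    haveI : Fact q.Prime := ⟨hqp⟩
    haveI : Fact q'.Prime := ⟨hqp'⟩
    rw [hm]
    exact qrBit_kernel_eq_of_isoClass S Q hS hQS hQ4 hiso8 hisoS hq hq' hT₀S hε'1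
  refine ⟨m, γ, hm0, fun ℓ hℓ hℓS => hmdiv ℓ hℓ (fun hT => hℓS (hT₀S hT)) hT₀p, hγa, ⟨hg', ?_⟩, hηconst, ?_, ?_, ?_⟩
  · -- the class
    rw [hmk]; congr 1; exact Units.ext (by rw [Units.val_mk0, Units.val_mk0, hker])
  · -- the sign: `sgn a = sgn ε`, `sgn m = sgn ε'`
    have hsm : signBit (m : ℚ) = signBit ε' := by
      rw [hm, signBit_mul hε'0 hprod0.ne', (signBit_eq_zero_iff hprod0.ne').mpr hprod0, add_zero]
    rw [hsm, hε']
    have hsa : signBit (a : ℚ) = if ε = 1 then 0 else 1 := by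
      by_cases h1 : ε = 1
      · rw [if_pos h1]; exact (signBit_eq_zero_iff a.ne_zero).mpr (hεpos.mp h1)
      · rw [if_neg h1, signBit, if_pos]
        exact lt_of_le_of_ne (not_lt.mp fun hlt => h1 (hεpos.mpr hlt)) a.ne_zero
    rw [hsa]
    rcases hε with h1 | h1 <;> by_cases hpT : p₀ ∈ T
    · rw [if_pos h1, h1, if_pos hpT, hγ, if_pos hpT, signBit]; norm_num; decide
    · rw [if_pos h1, h1, if_neg hpT, hγ, if_neg hpT, signBit]; norm_num
    · rw [if_neg (by rw [h1]; norm_num), h1, if_pos hpT, hγ, if_pos hpT, signBit]; norm_num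
    · rw [if_neg (by rw [h1]; norm_num), h1, if_neg hpT, hγ, if_neg hpT, signBit]; norm_num
  · -- the expansion of `qr_j(a)` at a row prime `j ∈ Q`
    intro j hj hjp
    haveI : Fact j.Prime := ⟨hjp⟩
    have hjp₀ : p₀ ≠ j := fun e => hp₀Q (e ▸ hj)
    have hX : qrBit j (if γ = 1 then -(p₀ : ℚ) else 1) =
        γ * (if jacobiSym (-(p₀ : ℤ)) j = -1 then (1 : ZMod 2) else 0) := by
      rcases zmod2_cases' γ with h0 | h1
      · rw [h0, if_neg zero_ne_one, qrBit_one, zero_mul]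
      · rw [h1, if_pos rfl, one_mul, qrBit_neg_natCast_prime_eq hp₀.out hjp₀]
    rw [qrBit_eq_of_mk_eq j hmk, Units.val_mk0, hker, qrBit_mul j (mul_ne_zero hm0 hX0) hprodQ0, qrBit_mul j hm0 hX0, hX,
      qrBit_prod_natCast_eq Q hQ (hQ4 j hj) hmaQ]
    congr 1
    -- `#(m_a∖j) + Σ_{i∈m_a∖j} G j i = Σ_{i∈Q∖j} (1 + G j i)·v_i(a)`
    have hfilt : (Q.filter (fun i => parityBit i (a : ℚ) = 1)).erase j =
        (Q.erase j).filter (fun i => parityBit i (a : ℚ) = 1) := by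
      ext i; simp only [Finset.mem_erase, Finset.mem_filter]; tauto
    rw [hfilt, Finset.card_eq_sum_ones, Nat.cast_sum, ← Finset.sum_add_distrib, Finset.sum_filter]
    refine Finset.sum_congr rfl fun i hi => ?_
    rcases zmod2_cases' (parityBit i (a : ℚ)) with h0 | h1
    · rw [h0, if_neg zero_ne_one, mul_zero]
    · rw [h1, if_pos rfl, mul_one, Nat.cast_one]
  · -- the residue at `p₀`
    have hX : qrBit p₀ (if γ = 1 then -(p₀ : ℚ) else 1) = γ := by
      rcases zmod2_cases' γ with h0 | h1
      · rw [h0, if_neg zero_ne_one, qrBit_one]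
      · rw [h1, if_pos rfl, show (-(p₀ : ℚ)) = (p₀ : ℚ) * (-1) by ring, qrBit_natCast_mul,
          qrBit_neg_one_eq_one_of_emod_four hp₀4]
    have hY : qrBit p₀ (∏ i ∈ Q.filter (fun i => parityBit i (a : ℚ) = 1), (i : ℚ)) =
        ∑ i ∈ Q, (if jacobiSym (-(p₀ : ℤ)) i = -1 then (1 : ZMod 2) else 0) * parityBit i (a : ℚ) := by
      rw [qrBit_prod_natCast _ (fun i hi => (hQ i (hmaQ hi)).ne_zero), Finset.sum_filter]
      refine Finset.sum_congr rfl fun i hi => ?_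
      have hip : i ≠ p₀ := fun e => hp₀Q (e ▸ hi)
      rcases zmod2_cases' (parityBit i (a : ℚ)) with h0 | h1
      · rw [h0, if_neg zero_ne_one, mul_zero]
      · rw [h1, if_pos rfl, mul_one, qrBit_natCast_prime_eq_jacobiBit (hQ i hi) hip hp₀4 (hQ4 i hi)]
    rw [qrBit_eq_of_mk_eq p₀ hmk, Units.val_mk0, hker, qrBit_mul p₀ (mul_ne_zero hm0 hX0) hprodQ0, qrBit_mul p₀ hm0 hX0,
      hX, hY]

end Kernel

end Summit.BirchSwinnertonDyer.BirchSwinnertonDyer.Theorems.GenusKolyvaginAtTwo.TorsionCellSEL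

end
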